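import Summits.Schanuel.Schanuel.Theorems.RootDecomp1KSiegelBridge02
import Summits.Schanuel.Schanuel.Theorems.RootDecomp1KSubspaceBranch04

/-!
# RootDecomp1KSiegelBridge — part 3 (RootDecomp1KSiegelBridge03): node 10's headlines re-pointed to the printed theorem

Census-1 gen 22, ×0 infrastructure on the (γ) lane (critic GO L2539; CLAUSE MAP ACK L2541).  One-line corollaries of
the bridge `siegelShapes_of_lang1983` (part 2): the K-line's uniform thin-fibre results of lens-1 g51 node 10
(`RootDecomp1KLevelFinite09` §8.8: level finiteness of every prime plane curve of `Y`-degree `≥ 2`, `ThinFibre m₀` for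
every `m₀ ≥ 2`, the (b)-cell `AlgebraicIndependent ℚ ![ℓ₂, ρ]` and item 31077's conclusion on the pair `(ℓ₂, ρ)` for
`ρ ∈ SkelFix m₀`) and the residual binders of record (`SiegelShapesOff`, `SiegelShapesOffAt m₀` of
`RootDecomp1KLevelFinite11`; `SiegelShapesOffSbAt m₀` of lens-1 g52 node 11, `RootDecomp1KSubspaceBranch04`) now
FOLLOW FROM the Literature named fact `Literature.NumberTheory.DiophantineGeometry.Lang1983_integralValues_planeCurve_parametric`
(Lang 1983 Ch. 8 Thm 2.4 + Thm 5.1 + p. 165 as printed and typed; cite item wi-102309).  Conditional-result class: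
the antecedent is a THEOREM IN PRINT that is NOT proved in the tree.  Rung 0 — nothing here proves Schanuel; items
33364 / 31077 (∀-statements) stay OPEN; no lens or census credit (K-R40 (viii)(γ), K-R41).
-/

noncomputable section

open Polynomial LiouvilleNumber

namespace Summit.Schanuel.Schanuel.Theorems.RootDecomp1KSiegelBridge

open Summit.Schanuel.Schanuel.Theorems.RootDecomp1KSkelCell (SkelLiouvilleFix)
open Summit.Schanuel.Schanuel.Theorems.RootDecomp1KDegreeLadder (ThinFibre)
open Summit.Schanuel.Schanuel.Theorems.RootDecomp1KLevelFinite
open Summit.Schanuel.Schanuel.Theorems.RootDecomp1KSubspaceBranch (SiegelShapesOffSbAt siegelShapesOffSbAt_of_off)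
open Literature.NumberTheory.DiophantineGeometry (Lang1983_integralValues_planeCurve_parametric)

/-- **LEVEL FINITENESS OF EVERY PRIME PLANE CURVE OF `Y`-DEGREE `≥ 2`, FROM LANG 1983 Thm 2.4 + 5.1 AS PRINTED.** -/
theorem levelFinite_of_lang1983 (hL : Lang1983_integralValues_planeCurve_parametric) :
    ∀ P : ℤ[X][X], Prime P → 2 ≤ P.natDegree → LevelFinite P :=
  levelFinite_of_siegelShapes'' (siegelShapes_of_lang1983 hL)

/-- **THE UNIFORM THIN-FIBRE RESIDUAL `ThinFibre m₀`, EVERY `m₀ ≥ 2`, FROM LANG 1983 Thm 2.4 + 5.1 AS PRINTED.** -/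
theorem thinFibre_of_lang1983 (hL : Lang1983_integralValues_planeCurve_parametric) {m₀ : ℕ} (hm : 2 ≤ m₀) :
    ThinFibre m₀ :=
  thinFibre_of_siegelShapes'' (siegelShapes_of_lang1983 hL) hm

/-- **THE (b)-CELL `AlgebraicIndependent ℚ ![ℓ₂, ρ]`, `ρ ∈ SkelFix m₀`, `m₀ ≥ 2`, FROM LANG 1983 AS PRINTED.** -/
theorem b_of_lang1983 (hL : Lang1983_integralValues_planeCurve_parametric) {m₀ : ℕ} (hm : 2 ≤ m₀) (ρ : ℝ)
    (hρ : SkelLiouvilleFix m₀ ρ) : AlgebraicIndependent ℚ ![((liouvilleNumber 2 : ℝ) : ℂ), (ρ : ℂ)] :=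
  b_of_siegelShapes'' (siegelShapes_of_lang1983 hL) hm ρ hρ

/-- **ITEM 31077's CONCLUSION ON `(ℓ₂, ρ)`, `ρ ∈ SkelFix m₀`, `m₀ ≥ 2`, FROM LANG 1983 AS PRINTED** (binders verbatim
+ the cell line `Set.range z = Set.range ![ℓ₂, ρ]`). -/
theorem coordLiouvilleSchanuel_pair_of_lang1983 (hL : Lang1983_integralValues_planeCurve_parametric) {m₀ : ℕ}
    (hm : 2 ≤ m₀) {ρ : ℝ} (hρ : SkelLiouvilleFix m₀ ρ) :
    ∀ (n : ℕ) (z : Fin n → ℂ), LinearIndependent ℚ z →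
      Set.range z = Set.range ![((liouvilleNumber 2 : ℝ) : ℂ), (ρ : ℂ)] →
      (∃ w ∈ Submodule.span ℚ (Set.range z), Liouville w.re ∨ Liouville w.im) →
      (n : Cardinal) ≤ Algebra.trdeg ℚ
        ↥(IntermediateField.adjoin ℚ (Set.range z ∪ Set.range (Complex.exp ∘ z))) :=
  coordLiouvilleSchanuel_pair_of_siegelShapes'' (siegelShapes_of_lang1983 hL) hm hρ

/-- the residual binder of record after g51 ADDENDUM-3, `SiegelShapesOff`, from LANG 1983 as printed. -/
theorem siegelShapesOff_of_lang1983 (hL : Lang1983_integralValues_planeCurve_parametric) : SiegelShapesOff :=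
  siegelShapesOff_of_siegelShapes (siegelShapes_of_lang1983 hL)

/-- the per-quality residual binder of record, `SiegelShapesOffAt m₀` (`m₀ ≥ 2`), from LANG 1983 as printed. -/
theorem siegelShapesOffAt_of_lang1983 (hL : Lang1983_integralValues_planeCurve_parametric) {m₀ : ℕ} (hm : 2 ≤ m₀) :
    SiegelShapesOffAt m₀ :=
  siegelShapesOffAt_of_off (siegelShapesOff_of_lang1983 hL) hm

/-- node 11's re-booked residual, `SiegelShapesOffSbAt m₀` (`m₀ ≥ 2`), from LANG 1983 as printed — so that node 11's
`thinFibre_of_padicSubspace_offSbAt` reads «`ThinFibre m₀ ⟸ PadicSubspace ∧ Lang 1983`», both antecedents print facts. -/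
theorem siegelShapesOffSbAt_of_lang1983 (hL : Lang1983_integralValues_planeCurve_parametric) {m₀ : ℕ} (hm : 2 ≤ m₀) :
    SiegelShapesOffSbAt m₀ :=
  siegelShapesOffSbAt_of_off (siegelShapesOff_of_lang1983 hL) hm

end Summit.Schanuel.Schanuel.Theorems.RootDecomp1KSiegelBridge

end
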